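import Mathlib
import HarnessLib
import Summits.HubbardSuperconductivity.HubbardSuperconductivity.Theorems.KLProgrammeH10TwoPointLimitKlAnisoNarrowConeCount
import Summits.HubbardSuperconductivity.HubbardSuperconductivity.Theorems.KLProgrammeH10TwoPointLimitKlAnisoTightBundleCountFrame

/-!
# Route `KLProgramme` — K3 engine (stmt-HubbardSuperconductivity-20437), stub (b) (ℓ)/(I2), located item «ON-CLASS-KB» (K′):
# the narrow (double-cone) count SPECIALISED TO THE FRAME'S CURVE `θ ↦ klFermiPoint μ K θ`

Cell gate-hubbard-kl, seat p4 g13.  `…KlAnisoNarrowConeCount.card_narrowCone_target_le` is stated for an abstract polar, centrally symmetric,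
torus-Lipschitz centre map `P` under the target hypothesis `hV` (`‖2πG₀ − pinned signed point‖_∞ > tol`).  For the frame's Fermi point the three
structural hypotheses are discharged as in `…KlAnisoTightBundleCountFrame`, and `hV` follows from a smallness condition on `tol`: the pinned signed
point `± k_F(θ)` has a coordinate `≥ u_min/2` in modulus (radius `≥ u_min`, `max(|cos|,|sin|) ≥ 1/2`) and every coordinate `≤ π√2` (radius `≤ π√2`,
k3c3-p3's `frameRadius_le`), so `‖2πG₀ − (±k_F)‖_∞ ≥ min(u_min/2, 2π − π√2) =: v₀ > 0` for EVERY `G₀ ∈ ℤ²`.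

* `exists_abs_target_sub_ge` — the `‖2πG₀ − w‖_∞ ≥ min(v_min, 2π − R)` step for a vector `w` with `‖w‖_∞ ≤ R` and a coordinate `≥ v_min`;
* `card_narrowCone_target_le_frame` — the count for a frame of `C²` size `A` on a band window (`2A < Dt_min`), under `tol < min(u_min/2, 2π − π√2)`;
* **`card_narrowCone_target_le_window`** — for every renormalisation package `R`: thresholds `c₃, U₀ > 0` and constants `Λ ≥ 0`, `r₀, v₀ > 0` (package /
  window constants only) such that for every admissible frame (`FrameOK R U (nScales β) ν K`, `μ ∈ klWindowC`), every scale `k` and all data with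
  `((m+1)C + mΛC′)·w_k < v₀`, the narrow class has `≤ 2(8π((m+1)C + mΛC′)/r₀ + 2)·(8(2C′+1))^m` members.
PROVED; no definitions, no named facts; nothing here asserts anything about the model or superconductivity. [folklore] counting.
-/

noncomputable section

namespace Summit.HubbardSuperconductivity.HubbardSuperconductivity.Theorems.PerturbedFermiCurve

set_option linter.dupNamespace false -- summit = problem name (single-conjunct summit), D-0017

open Classical
open Real Set Finset
open Literature.MathematicalPhysics.QuantumLattice Literature.MathematicalPhysics.QuantumLattice.BandSectorCounting
open Literature.MathematicalPhysics.QuantumLattice.FermiRG Literature.MathematicalPhysics.QuantumLattice.FermiRG.BGM2003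
open Summit.HubbardSuperconductivity.HubbardSuperconductivity.Theorems.DispersionFlow
open Summit.HubbardSuperconductivity.HubbardSuperconductivity.Theorems.KLRegimeSplit

/-! ## §1 The target is never small -/

/-- If `‖w‖_∞ ≤ R` and some coordinate of `w` has modulus `≥ v_min`, then for EVERY `G₀ ∈ ℤ²` some coordinate of `2πG₀ − w` has modulus
`≥ min(v_min, 2π − R)` (`G₀ = 0`: the large coordinate of `w`; `G₀ ≠ 0`: a coordinate with `|2πG₀ j| ≥ 2π`). [folklore] -/
theorem exists_abs_target_sub_ge {w : Fin 2 → ℝ} {R vmin : ℝ} (hR : ∀ j, |w j| ≤ R) (hmin : ∃ j, vmin ≤ |w j|) (G₀ : Fin 2 → ℤ) :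
    ∃ j : Fin 2, min vmin (2 * π - R) ≤ |2 * π * (G₀ j : ℝ) - w j| := by
  by_cases hG : ∀ j, G₀ j = 0
  · obtain ⟨j, hj⟩ := hmin
    refine ⟨j, (min_le_left _ _).trans ?_⟩
    rw [hG j, Int.cast_zero, mul_zero, zero_sub, abs_neg]; exact hj
  · push Not at hG
    obtain ⟨j, hj⟩ := hG
    refine ⟨j, (min_le_right _ _).trans ?_⟩
    have h1 : (1 : ℝ) ≤ |(G₀ j : ℝ)| := by
      have : (1 : ℤ) ≤ |G₀ j| := Int.one_le_abs hj
      have h' : ((1 : ℤ) : ℝ) ≤ ((|G₀ j| : ℤ) : ℝ) := by exact_mod_cast this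
      rwa [Int.cast_one, Int.cast_abs] at h'
    have h2 : 2 * π ≤ |2 * π * (G₀ j : ℝ)| := by
      rw [abs_mul, abs_of_pos (by positivity : (0 : ℝ) < 2 * π)]; nlinarith [Real.pi_pos]
    have h3 := abs_sub_abs_le_abs_sub (2 * π * (G₀ j : ℝ)) (w j)
    linarith [hR j]

/-- `2π − π√2 > 0`. -/
theorem two_pi_sub_pi_sqrt_two_pos : 0 < 2 * π - π * Real.sqrt 2 := by
  have h2 : Real.sqrt 2 < 2 := by
    rw [show (2 : ℝ) = Real.sqrt 4 from by rw [show (4 : ℝ) = 2 ^ 2 by norm_num, Real.sqrt_sq (by norm_num : (0 : ℝ) ≤ 2)]]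
    exact Real.sqrt_lt_sqrt (by norm_num) (by norm_num)
  nlinarith [Real.pi_pos]

/-! ## §2 The count for one frame -/

section Frame

variable {a b : ℝ} (B : BandBounds a b) {K : TrigPolyC4v} {A : ℝ}
  (hA : ∀ p : Momentum, ∀ j ≤ 2, ‖iteratedFDeriv ℝ j (frameShift K) p‖ ≤ A) {μ : ℝ} (hlo : a ≤ μ - A) (hhi : μ + A ≤ b)
  (hDt : 2 * A < B.Dtmin)

include B hA hlo hhi hDt in
/-- **The narrow (double-cone) count on the frame's curve.**  For a frame `K` of `C²` size `A` on a band window with `[μ − A, μ + A] ⊆ [a, b]` and `2A < Dt_min`,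
with `Lip_A = π√2(1 + (4+2A)/(Dt_min − 2A))`: if `((m+1)C + m·Lip_A·C′)·w_k < min(u_min/2, 2π − π√2)` then the coarse tuples `σ′` (scale `k`) with `σ′ p = ℓ`,
signed curve centre points summing to within `(m+1)·C·w_k` of `2πG₀`, and all non-pinned half-turned indices within `C′` of a common sector modulo `2^k`
number at most `2(8π((m+1)C + m·Lip_A·C′)/u_min + 2)·(8(2C′+1))^m` — uniformly in `k` and in `G₀`. [folklore] -/
theorem card_narrowCone_target_le_frame {k m : ℕ} (p : Fin (m + 1)) (ℓ : SectorLeg (sectorCount k)) (G₀ : Fin 2 → ℤ) {C : ℝ} (hC : 0 ≤ C) (C' : ℕ)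
    (hsmall : (((m : ℝ) + 1) * C + m * (π * Real.sqrt 2 * (1 + (4 + 2 * A) / (B.Dtmin - 2 * A))) * C') * sectorWidth k <
      min (B.umin / 2) (2 * π - π * Real.sqrt 2)) :
    (((univ : Finset (Fin (m + 1) → SectorLeg (sectorCount k))).filter fun σ' =>
        σ' p = ℓ ∧
        (∀ j : Fin 2, |∑ i, (if (σ' i).2 = 0 then klFermiPoint μ K (sectorCenter k (σ' i).1.1) j
            else -klFermiPoint μ K (sectorCenter k (σ' i).1.1) j) - 2 * π * (G₀ j : ℝ)| ≤ ((m : ℝ) + 1) * C * sectorWidth k) ∧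
        ∃ b : Fin (sectorCount k), ∀ i, i ≠ p → ∃ D : ℤ, |D| ≤ C' ∧ ((2 : ℤ) ^ k) ∣
          ((((if (σ' i).2 = 0 then ((σ' i).1.1 : ℕ) else
              if ((σ' i).1.1 : ℕ) < 2 ^ k then ((σ' i).1.1 : ℕ) + 2 ^ k else ((σ' i).1.1 : ℕ) - 2 ^ k : ℕ) : ℤ)) - b - D)).card : ℝ) ≤
      2 * (8 * π * (((m : ℝ) + 1) * C + m * (π * Real.sqrt 2 * (1 + (4 + 2 * A) / (B.Dtmin - 2 * A))) * C') / B.umin + 2) *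
        (8 * (2 * (C' : ℝ) + 1)) ^ m := by
  have hA0 : 0 ≤ A := le_trans (norm_nonneg _) (hA 0 0 (by norm_num))
  have hLip0 : 0 ≤ π * Real.sqrt 2 * (1 + (4 + 2 * A) / (B.Dtmin - 2 * A)) := by
    have : 0 ≤ (4 + 2 * A) / (B.Dtmin - 2 * A) := div_nonneg (by linarith) (by linarith)
    positivity
  have hper : Function.Periodic (klFermiPoint μ K) (2 * π) := fun θ => by
    unfold klFermiPoint; rw [perturbedFermiRadius_add_two_pi, dir_add_two_pi]
  have hpolar : ∀ θ : ℝ, ∃ r : ℝ, B.umin ≤ r ∧ klFermiPoint μ K θ = r • dir θ :=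
    fun θ => ⟨_, umin_le_frameRadius B hA hlo hhi θ, rfl⟩
  have hanti : ∀ θ : ℝ, klFermiPoint μ K (θ + π) = -klFermiPoint μ K θ := fun θ => by
    unfold klFermiPoint
    rw [perturbedFermiRadius_add_pi (fun k => by simp [TrigPolyC4v.eval_neg]) μ θ, dir_add_pi, smul_neg]
  -- the target hypothesis `hV`
  have humin := B.umin_pos
  set θc : ℝ := sectorCenter k ℓ.1.1 with hθc
  have hu := umin_le_frameRadius B hA hlo hhi θc
  have hule := frameRadius_le B hA hlo hhi θc
  set u : ℝ := perturbedFermiRadius (fun q : Fin 2 → ℝ => -K.eval q) μ θc with hudef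
  have hupos : 0 < u := lt_of_lt_of_le humin hu
  have hPt : klFermiPoint μ K θc = u • dir θc := rfl
  set w : Fin 2 → ℝ := fun j => if ℓ.2 = 0 then klFermiPoint μ K θc j else -klFermiPoint μ K θc j with hwdef
  have habs : ∀ j, |w j| = |klFermiPoint μ K θc j| := by
    intro j; simp only [hwdef]; split_ifs <;> simp [abs_neg]
  have hcos := Real.abs_cos_le_one θc
  have hsin := Real.abs_sin_le_one θc
  have hRw : ∀ j, |w j| ≤ π * Real.sqrt 2 := by
    intro j; rw [habs j, hPt]
    fin_cases j
    · simp only [Pi.smul_apply, smul_eq_mul, dir_zero, Fin.zero_eta]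
      rw [abs_mul, abs_of_pos hupos]; nlinarith
    · simp only [Pi.smul_apply, smul_eq_mul, dir_one, Fin.mk_one]
      rw [abs_mul, abs_of_pos hupos]; nlinarith
  have hminw : ∃ j, B.umin / 2 ≤ |w j| := by
    by_contra hcon
    push Not at hcon
    have h0 := hcon 0; have h1 := hcon 1
    rw [habs, hPt] at h0 h1
    simp only [Pi.smul_apply, smul_eq_mul, dir_zero, dir_one] at h0 h1
    rw [abs_mul, abs_of_pos hupos] at h0 h1
    have hc2 : |Real.cos θc| < 1 / 2 := by
      by_contra h; push Not at h; exact absurd h0 (not_lt.2 (by nlinarith))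
    have hs2 : |Real.sin θc| < 1 / 2 := by
      by_contra h; push Not at h; exact absurd h1 (not_lt.2 (by nlinarith))
    have := Real.sin_sq_add_cos_sq θc
    nlinarith [sq_abs (Real.cos θc), sq_abs (Real.sin θc), abs_nonneg (Real.cos θc), abs_nonneg (Real.sin θc)]
  have hV : ∃ j : Fin 2, (((m : ℝ) + 1) * C + m * (π * Real.sqrt 2 * (1 + (4 + 2 * A) / (B.Dtmin - 2 * A))) * C') * sectorWidth k <
      |2 * π * (G₀ j : ℝ) - (if ℓ.2 = 0 then klFermiPoint μ K (sectorCenter k ℓ.1.1) j else -klFermiPoint μ K (sectorCenter k ℓ.1.1) j)| := by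
    obtain ⟨j, hj⟩ := exists_abs_target_sub_ge hRw hminw G₀
    exact ⟨j, hsmall.trans_le hj⟩
  exact card_narrowCone_target_le (klFermiPoint μ K) B.umin_pos hLip0 hpolar hanti
    (abs_apply_sub_le_mul_torusDist_of_periodic hper (norm_klFermiPoint_sub_le B hA hlo hhi hDt)) p ℓ G₀ hC C' hV

end Frame

/-! ## §3 The count for every admissible frame on the analysis window -/

/-- **The narrow (double-cone) count for ADMISSIBLE frames in the KL regime.**  For every renormalisation package `R` (`Gfr ≥ 0`) there are thresholds
`c₃, U₀ > 0`, a Lipschitz constant `Λ ≥ 0`, a radius `r₀ > 0` and a target floor `v₀ > 0` — depending on `R` and the window only — such that for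
`0 < c ≤ c₃`, `0 < U ≤ U₀`, `klBetaMin ≤ β ≤ e^{c/U²}`, `μ ∈ klWindowC`, every frame with `FrameOK R U (nScales β) ν K`, every scale `k`, `m + 1` legs and data
with `((m+1)C + mΛC′)·w_k < v₀`: the narrow class (pinned label `ℓ` at `p`, on the umklapp class of `G₀` with tolerance `(m+1)·C·w_k`, non-pinned half-turned
indices within `C′` of a common sector modulo `2^k`) has at most `2(8π((m+1)C + mΛC′)/r₀ + 2)·(8(2C′+1))^m` members. [folklore] -/
theorem card_narrowCone_target_le_window (R : RenConsts) (hR : ∀ j, 0 ≤ R.Gfr j) :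
    ∃ c₃ : ℝ, 0 < c₃ ∧ ∃ U₀ : ℝ, 0 < U₀ ∧ ∃ Λ : ℝ, 0 ≤ Λ ∧ ∃ r₀ : ℝ, 0 < r₀ ∧ ∃ v₀ : ℝ, 0 < v₀ ∧
      ∀ c : ℝ, 0 < c → c ≤ c₃ → ∀ U : ℝ, 0 < U → U ≤ U₀ → ∀ β : ℝ, klBetaMin ≤ β → β ≤ Real.exp (c / U ^ 2) →
      ∀ μ ∈ klWindowC, ∀ (ν : ℝ) (K : TrigPolyC4v), FrameOK R U (nScales β) ν K →
      ∀ (k m : ℕ) (p : Fin (m + 1)) (ℓ : SectorLeg (sectorCount k)) (G₀ : Fin 2 → ℤ) (C : ℝ), 0 ≤ C → ∀ C' : ℕ,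
      (((m : ℝ) + 1) * C + m * Λ * C') * sectorWidth k < v₀ →
      (((univ : Finset (Fin (m + 1) → SectorLeg (sectorCount k))).filter fun σ' =>
          σ' p = ℓ ∧
          (∀ j : Fin 2, |∑ i, (if (σ' i).2 = 0 then klFermiPoint μ K (sectorCenter k (σ' i).1.1) j
              else -klFermiPoint μ K (sectorCenter k (σ' i).1.1) j) - 2 * π * (G₀ j : ℝ)| ≤ ((m : ℝ) + 1) * C * sectorWidth k) ∧
          ∃ b : Fin (sectorCount k), ∀ i, i ≠ p → ∃ D : ℤ, |D| ≤ C' ∧ ((2 : ℤ) ^ k) ∣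
            ((((if (σ' i).2 = 0 then ((σ' i).1.1 : ℕ) else
                if ((σ' i).1.1 : ℕ) < 2 ^ k then ((σ' i).1.1 : ℕ) + 2 ^ k else ((σ' i).1.1 : ℕ) - 2 ^ k : ℕ) : ℤ)) - b - D)).card : ℝ) ≤
        2 * (8 * π * (((m : ℝ) + 1) * C + m * Λ * C') / r₀ + 2) * (8 * (2 * (C' : ℝ) + 1)) ^ m := by
  -- thresholds exactly as in k3c3-p3's `frameCurve_lipschitz_of_frameOK`
  have ha : (-4 : ℝ) < -1.1 := by norm_num
  have hab : (-1.1 : ℝ) ≤ -0.1 := by norm_num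
  have hb : (-0.1 : ℝ) < 0 := by norm_num
  set B := bandBounds ha hab hb with hBdef
  have hDt := B.Dtmin_pos
  set κ : ℝ := min B.Dtmin (1 / 5) with hκdef
  have hκ : 0 < κ := lt_min hDt (by norm_num)
  obtain ⟨c₃, hc₃, U₀, hU₀, hthr⟩ := frame_thresholds hR hκ
  set Λ : ℝ := π * Real.sqrt 2 * (1 + (4 + B.Dtmin) / (B.Dtmin / 2)) with hΛdef
  have hΛ0 : 0 ≤ Λ := by positivity
  have hv₀ : 0 < min (B.umin / 2) (2 * π - π * Real.sqrt 2) := lt_min (by linarith [B.umin_pos]) two_pi_sub_pi_sqrt_two_pos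
  refine ⟨c₃, hc₃, U₀, hU₀, Λ, hΛ0, B.umin, B.umin_pos, _, hv₀, ?_⟩
  intro c hc hcle U hU hUle β hβmin hβc μ hμ ν K hK k m p ℓ G₀ C hC C' hsmall
  have hAf : ∀ p : Momentum, ∀ j ≤ 2, ‖iteratedFDeriv ℝ j (frameShift K) p‖ ≤
      2 * R.Gfr 0 * |U| + 2 * R.Gfr 1 * U ^ 2 + R.Gfr 2 * (c / Real.log 4) := fun p j hj =>
    norm_iteratedFDeriv_frameShift_le_of_frameOK_regime hR hc.le hβmin hβc hK p hj
  set A := 2 * R.Gfr 0 * |U| + 2 * R.Gfr 1 * U ^ 2 + R.Gfr 2 * (c / Real.log 4) with hAdef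
  have h4A : 4 * A ≤ κ := hthr c U hc.le hcle hU hUle
  have hA0 : 0 ≤ A := le_trans (norm_nonneg _) (hAf 0 0 (by norm_num))
  have hκDt : κ ≤ B.Dtmin := min_le_left _ _
  have hκ5 : κ ≤ 1 / 5 := min_le_right _ _
  have hADt : 2 * A < B.Dtmin := by linarith
  have hA20 : A ≤ 1 / 20 := by linarith
  obtain ⟨hlo, hhi⟩ := PerturbedFermiCurve.klWindowC_margin hμ hA20
  have hden : B.Dtmin / 2 ≤ B.Dtmin - 2 * A := by linarith
  have hfrac : (4 + 2 * A) / (B.Dtmin - 2 * A) ≤ (4 + B.Dtmin) / (B.Dtmin / 2) := by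
    rw [div_le_div_iff₀ (by linarith) (by linarith)]
    nlinarith
  have hΛ1 : π * Real.sqrt 2 * (1 + (4 + 2 * A) / (B.Dtmin - 2 * A)) ≤ Λ := by
    rw [hΛdef]
    apply mul_le_mul_of_nonneg_left _ (by positivity)
    linarith
  have hw := sectorWidth_pos k
  have hC'0 : (0 : ℝ) ≤ C' := Nat.cast_nonneg _
  have hm0 : (0 : ℝ) ≤ m := Nat.cast_nonneg _
  have hmono : ((m : ℝ) + 1) * C + m * (π * Real.sqrt 2 * (1 + (4 + 2 * A) / (B.Dtmin - 2 * A))) * C' ≤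
      ((m : ℝ) + 1) * C + m * Λ * C' := by
    have : m * (π * Real.sqrt 2 * (1 + (4 + 2 * A) / (B.Dtmin - 2 * A))) * C' ≤ m * Λ * C' := by
      apply mul_le_mul_of_nonneg_right _ hC'0
      exact mul_le_mul_of_nonneg_left hΛ1 hm0
    linarith
  have hsmall' : (((m : ℝ) + 1) * C + m * (π * Real.sqrt 2 * (1 + (4 + 2 * A) / (B.Dtmin - 2 * A))) * C') * sectorWidth k <
      min (B.umin / 2) (2 * π - π * Real.sqrt 2) :=
    lt_of_le_of_lt (mul_le_mul_of_nonneg_right hmono hw.le) hsmall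
  have h := card_narrowCone_target_le_frame B hAf hlo hhi hADt p ℓ G₀ hC C' hsmall'
  refine h.trans (mul_le_mul_of_nonneg_right ?_ (by positivity))
  have hu := B.umin_pos
  have hnum : 8 * π * (((m : ℝ) + 1) * C + m * (π * Real.sqrt 2 * (1 + (4 + 2 * A) / (B.Dtmin - 2 * A))) * C') ≤
      8 * π * (((m : ℝ) + 1) * C + m * Λ * C') := by nlinarith [Real.pi_pos]
  have := div_le_div_of_nonneg_right hnum hu.le
  linarith

end Summit.HubbardSuperconductivity.HubbardSuperconductivity.Theorems.PerturbedFermiCurve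

end
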